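import Mathlib
import Literature.Analysis.FluidPDE.TaoCascadeODE
import HarnessLib

/-!
# `HeteroclinicTriggerChain` — crux `TriggerChainFrontStep` (item stmt-NavierStokesRegularity-22785):
  the (parity) clause IS a ℤ₂-symmetry — flipping every trigger amplitude maps flows to flows

The crux's (parity) clause (every structure constant with an odd number of trigger slots `i₁` vanishes)
says exactly that the cascade nonlinearity is EQUIVARIANT under the sign flip of the trigger mode:
with `flip X := (X with X_{i₁,·} ↦ −X_{i₁,·})`,

  `quadTerm ε₀ α (flip X) i n = (−1)^{[i = i₁]} · quadTerm ε₀ α X i n`   (`htcTF_quadTerm_flip`),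

so the flip of an exact flow of `α₀ + βσ` (both tables with parity) is an exact flow
(`htcTF_flip_exact_flow`). Use: the seed coefficient `s = 2σ i₁ i₀ i₁ (0,0,1)` and the datum kick may be
taken POSITIVE without loss of generality (the delay/seed lemmas of the line are stated for positive
triggers).

HONEST FRAMING: finite algebra of Tao-type MODEL lattice tables (Tao 2016 §4); helper for the crux (no stub
credit); nothing here is a statement about the Navier–Stokes equations; no summit, rung or crux is proved.
-/

noncomputable section

set_option linter.dupNamespace false

open Real Set

namespace Summit.NavierStokesRegularity.NavierStokesRegularity.Theorems

open Literature.Analysis.FluidPDE Literature.Analysis.FluidPDE.TaoCascade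

/-- **Trigger flip is a symmetry of the nonlinearity** under the (parity) clause:
`quadTerm ε₀ α (flip X) i n t = (if i = i₁ then −1 else 1) · quadTerm ε₀ α X i n t`. [folklore] -/
theorem htcTF_quadTerm_flip (ε₀ : ℝ) {m : ℕ} (α : Fin m → Fin m → Fin m → ℤ × ℤ × ℤ → ℝ) (i₁ : Fin m)
    (hpar : ∀ (j₁ j₂ j₃ : Fin m) (μ : ℤ × ℤ × ℤ),
      Xor (Xor (j₁ = i₁) (j₂ = i₁)) (j₃ = i₁) → α j₁ j₂ j₃ μ = 0)
    (X : Fin m → ℤ → ℝ → ℝ) (i : Fin m) (n : ℤ) (t : ℝ) :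
    quadTerm ε₀ α (fun j k s => if j = i₁ then -X j k s else X j k s) i n t =
      (if i = i₁ then -1 else 1) * quadTerm ε₀ α X i n t := by
  unfold quadTerm
  rw [Finset.mul_sum]
  refine Finset.sum_congr rfl fun a _ => ?_
  rw [Finset.mul_sum]
  refine Finset.sum_congr rfl fun b _ => ?_
  rw [Finset.mul_sum]
  refine Finset.sum_congr rfl fun μ _ => ?_
  by_cases ha : a = i₁
  · by_cases hb : b = i₁
    · by_cases hi : i = i₁
      · have hz : α a b i μ = 0 := hpar a b i μ (by simp [Xor, ha, hb, hi])
        simp [hz]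
      · simp [ha, hb, hi]
    · by_cases hi : i = i₁
      · simp [ha, hb, hi]
      · have hz : α a b i μ = 0 := hpar a b i μ (by simp [Xor, ha, hb, hi])
        simp [hz]
  · by_cases hb : b = i₁
    · by_cases hi : i = i₁
      · simp [ha, hb, hi]
      · have hz : α a b i μ = 0 := hpar a b i μ (by simp [Xor, ha, hb, hi])
        simp [hz]
    · by_cases hi : i = i₁
      · have hz : α a b i μ = 0 := hpar a b i μ (by simp [Xor, ha, hb, hi])
        simp [hz]
      · simp [ha, hb, hi]

/-- **The flip of an exact flow is an exact flow.** If `S` solves the exact equations of `α₀ + βσ` on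
`[0,T]` (within the segment) and both tables satisfy the (parity) clause at `i₁`, then so does the
family with every trigger amplitude `S_{i₁,k}` replaced by `−S_{i₁,k}`. [folklore] -/
theorem htcTF_flip_exact_flow {m : ℕ} (α₀ σ : Fin m → Fin m → Fin m → ℤ × ℤ × ℤ → ℝ) (i₁ : Fin m)
    (hpar : ∀ (j₁ j₂ j₃ : Fin m) (μ : ℤ × ℤ × ℤ),
      Xor (Xor (j₁ = i₁) (j₂ = i₁)) (j₃ = i₁) → α₀ j₁ j₂ j₃ μ = 0)
    (hσpar : ∀ (j₁ j₂ j₃ : Fin m) (μ : ℤ × ℤ × ℤ),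
      Xor (Xor (j₁ = i₁) (j₂ = i₁)) (j₃ = i₁) → σ j₁ j₂ j₃ μ = 0)
    (β : ℝ) (S : Fin m → ℤ → ℝ → ℝ) {T : ℝ}
    (hS : ∀ i k, ∀ t ∈ Icc 0 T, HasDerivWithinAt (S i k)
      (quadTerm 1 α₀ S i k t + β * quadTerm 1 σ S i k t) (Icc 0 T) t) :
    ∀ i k, ∀ t ∈ Icc 0 T, HasDerivWithinAt ((fun j k s => if j = i₁ then -S j k s else S j k s) i k)
      (quadTerm 1 α₀ (fun j k s => if j = i₁ then -S j k s else S j k s) i k t +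
        β * quadTerm 1 σ (fun j k s => if j = i₁ then -S j k s else S j k s) i k t) (Icc 0 T) t := by
  intro i k t ht
  rw [htcTF_quadTerm_flip 1 α₀ i₁ hpar, htcTF_quadTerm_flip 1 σ i₁ hσpar]
  by_cases hi : i = i₁
  · simp only [hi, if_true]
    have h := (hS i₁ k t ht).neg
    refine h.congr_deriv ?_
    ring
  · simp only [hi, if_false]
    have h := hS i k t ht
    refine h.congr_deriv ?_
    ring

end Summit.NavierStokesRegularity.NavierStokesRegularity.Theorems

end
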